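import Literature.Algebra.Homology.DiscreteRepLayerColimitGroupCohomology
import Literature.Algebra.Homology.DiscreteRepStandardResolution
import Literature.Algebra.Homology.DiscreteRepContinuous
import HarnessLib

/-!
# Vanishing of `Hⁿ_cont(Γ, A)` (trivial discrete coefficients) descends along a family of quotients
# `Γ ↠ Γ'ᵢ` cofinal among the open normal subgroups (Serre, *Galois Cohomology* I §2.2 Prop. 8)

Topic `Algebra/Homology`; namespace `Literature.Algebra.Homology.DiscreteRep`.  THEOREMS ONLY (no
definition, no named fact, no instance, no `sorry`).  Sequel of `DiscreteRepLayerColimitGroupCohomology`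
(door-c4: `Extⁿ_{C_Γ}(k, M) = lim→_U Hⁿ(Γ⧸U, M^U)`, `LayerColimit.forall_ext_eq_zero_iff`: the limit
group vanishes iff every layer class dies under some transition `stepG`) and of
`DiscreteRepStandardResolution` (`extTrivAddEquivContinuousCohomology : Extⁿ_{C_Γ}(k, X) ≃+ Hⁿ_cont(Γ, X)`
for `Γ` compact and `X` discrete).

THE STATEMENT (`subsingleton_continuousCohomology_trivial_of_cofinal_surjections`).  Let `Γ` be a
profinite group acting TRIVIALLY (and continuously) on a discrete `k`-module `A`, and let
`θᵢ : Γ → Γ'ᵢ` (`i : ι`) be continuous SURJECTIVE homomorphisms onto profinite groups `Γ'ᵢ`, each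
acting trivially on the same `A`, such that every open normal subgroup `V ⊴ Γ` contains `ker θᵢ` for
some `i`.  If `Hⁿ_cont(Γ'ᵢ, A) = 0` for every `i`, then `Hⁿ_cont(Γ, A) = 0`.

PROOF (Serre I §2.2 Prop. 8: `Hⁿ(Γ, A) = lim→_V Hⁿ(Γ⧸V, A)`).  By the colimit theorem it suffices
that every layer class `c ∈ Hⁿ(Γ⧸V, A^V)` dies under some transition `Hⁿ(Γ⧸V, A^V) → Hⁿ(Γ⧸W, A^W)`.
Pick `i` with `ker θᵢ ≤ V`; then `V' := θᵢ(V)` is open normal in `Γ' := Γ'ᵢ`, `Γ⧸V ≅ Γ'⧸V'`, and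
(trivial actions) `A^V ≅ A^{V'}`, so `c` is the image of a layer class `c'` of `Γ'`
(`groupCohomology.mapIso`).  Since `Hⁿ_cont(Γ', A) = 0`, `c'` dies in some deeper layer `W' ≤ V'`
(`LayerColimit.exists_stepG_eq_zero`); with `W := θᵢ⁻¹(W') ≤ V` again `Γ⧸W ≅ Γ'⧸W'`, and the
transport isomorphisms commute with the transitions (`groupCohomology.map_comp`), so `c` dies in
`Hⁿ(Γ⧸W, A^W)`.

* §1 `isOpen_coe_map_of_surjective`, `bijective_quotientMap_of_forall_mem_iff` — group-topological
  plumbing for a continuous surjection `θ : Γ ↠ Γ'` of profinite groups;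
* §2 `exists_stepG_eq_zero_of_surjection` — ONE layer: a layer class of `Γ` at `V ⊇ ker θ` dies deeper
  as soon as `Hⁿ_cont(Γ', A) = 0`;
* §3 `subsingleton_continuousCohomology_of_forall_ext_eq_zero` /
  `forall_ext_eq_zero_of_subsingleton_continuousCohomology` (`Hⁿ_cont = 0` ⟺ `Extⁿ_{C_Γ} = 0`) and
  **`subsingleton_continuousCohomology_trivial_of_cofinal_surjections`** — the statement above.

Written for lane «PT3-TC» of cell `bsd-eis` (crux `GoodLatticeBDPValue`, stmt-BirchSwinnertonDyer-19032):
the passage `H³(G_{K,S′}, μ_p) = 0` for the FINITE `S′ ⊆ S` ⟹ `H³(G_{K,S}, μ_p) = 0`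
(`K_S = ⋃_{S′} K_{S′}`, Neukirch–Schmidt–Wingberg VIII §3), file
`NumberTheory/GaloisCohomology/RestrictedRamificationH3MuOfFinite.lean`.  HONEST FRAMING: homological
algebra only; no arithmetic statement is proved here.

## References
* J.-P. Serre, *Galois Cohomology*, Springer (1997), I §2.2 Proposition 8 and Corollary 1
  (`H^q(G, A) = lim→ H^q(G/U, A^U)`; compatibility with `lim←` of groups). [SerreGaloisCohomology1997]
* J. Neukirch, A. Schmidt, K. Wingberg, *Cohomology of Number Fields*, 2nd ed. (2008), (1.5.1)
  (`Hⁿ(lim← Gᵢ, lim→ Aᵢ) = lim→ Hⁿ(Gᵢ, Aᵢ)`). [NeukirchSchmidtWingberg2008]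
-/

noncomputable section

universe u

namespace Literature.Algebra.Homology

namespace DiscreteRep

open CategoryTheory CategoryTheory.Limits CategoryTheory.Abelian
open Literature.NumberTheory.GaloisRepresentations
open _root_.TopRep _root_.ContRepresentation _root_.ContinuousCohomology

/-! ## §1 Continuous surjections of profinite groups: images of open normal subgroups, layer bijections -/

section Surjection

variable {Γ Γ' : Type u} [Group Γ] [TopologicalSpace Γ] [IsTopologicalGroup Γ] [CompactSpace Γ]
  [Group Γ'] [TopologicalSpace Γ'] [IsTopologicalGroup Γ'] [T2Space Γ']
  (θ : Γ →* Γ') (hθ : Continuous θ) (hs : Function.Surjective θ)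

include hθ hs in
/-- **The image of an open subgroup under a continuous surjection of a compact group onto a Hausdorff
group is open** (it is closed — the image of a compact set — and of finite index).
[cite: SerreGaloisCohomology1997, I §1.1] -/
theorem isOpen_coe_map_of_surjective (V : Subgroup Γ) (hV : IsOpen (V : Set Γ)) :
    IsOpen ((V.map θ : Subgroup Γ') : Set Γ') := by
  haveI : Finite (Γ ⧸ V) := Subgroup.quotient_finite_of_isOpen V hV
  haveI : V.FiniteIndex := Subgroup.finiteIndex_of_finite_quotient
  haveI : (V.map θ).FiniteIndex := by
    rw [Subgroup.finiteIndex_iff]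
    intro h0
    have hd := Subgroup.index_map_dvd V hs
    rw [h0] at hd
    exact (Subgroup.finiteIndex_iff.1 ‹V.FiniteIndex›) (Nat.eq_zero_of_zero_dvd hd)
  refine Subgroup.isOpen_of_isClosed_of_finiteIndex _ ?_
  have hc : IsCompact ((V.map θ : Subgroup Γ') : Set Γ') := by
    rw [Subgroup.coe_map]
    exact ((Subgroup.isClosed_of_isOpen V hV).isCompact).image hθ
  exact hc.isClosed

omit [TopologicalSpace Γ] [IsTopologicalGroup Γ] [CompactSpace Γ] [TopologicalSpace Γ']
  [IsTopologicalGroup Γ'] [T2Space Γ'] in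
include hs in
/-- **`Γ⧸U ≅ Γ'⧸U'` for `U = θ⁻¹(U')`**: the induced map of quotients is bijective when `θ` is onto and
`U` is exactly the preimage of `U'`. [cite: SerreGaloisCohomology1997, I §2.2 Proposition 8] -/
theorem bijective_quotientMap_of_forall_mem_iff (U : Subgroup Γ) [U.Normal] (U' : Subgroup Γ')
    [U'.Normal] (hU : ∀ g : Γ, g ∈ U ↔ θ g ∈ U') :
    Function.Bijective (QuotientGroup.map U U' θ fun g hg => (hU g).1 hg) := by
  constructor
  · rw [← MonoidHom.ker_eq_bot_iff, Subgroup.eq_bot_iff_forall]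
    intro q hq
    induction q using QuotientGroup.induction_on with
    | H g =>
      rw [MonoidHom.mem_ker, QuotientGroup.map_mk, QuotientGroup.eq_one_iff] at hq
      exact (QuotientGroup.eq_one_iff g).2 ((hU g).2 hq)
  · intro q
    induction q using QuotientGroup.induction_on with
    | H g' =>
      obtain ⟨g, rfl⟩ := hs g'
      exact ⟨QuotientGroup.mk g, rfl⟩

end Surjection

/-! ## §2 One layer: a layer class at `V ⊇ ker θ` dies deeper when `Hⁿ_cont(Γ', A) = 0` -/

section Layer

variable {k Γ Γ' : Type u} [CommRing k] [TopologicalSpace k] [Group Γ] [TopologicalSpace Γ]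
  [IsTopologicalGroup Γ] [CompactSpace Γ] [TotallyDisconnectedSpace Γ]
  [Group Γ'] [TopologicalSpace Γ'] [IsTopologicalGroup Γ'] [CompactSpace Γ'] [TotallyDisconnectedSpace Γ']
  [T2Space Γ']
  {A : Type u} [AddCommGroup A] [Module k A] [TopologicalSpace A] [DiscreteTopology A]
  [IsTopologicalAddGroup A] [ContinuousSMul k A]

omit [TotallyDisconnectedSpace Γ] in
/-- **Transport of one layer along `θ : Γ ↠ Γ'` (trivial coefficients).**  Let `ρ`, `ρ'` be the trivial
actions of `Γ`, `Γ'` on the discrete module `A`, `θ : Γ ↠ Γ'` a continuous surjection, and `V ⊴ Γ`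
open normal with `ker θ ≤ V`.  If `Extⁿ_{C_{Γ'}}(k, A) = 0` (i.e. `Hⁿ_cont(Γ', A) = 0`), then every class
`c ∈ Hⁿ(Γ⧸V, A^V)` dies under some transition `Hⁿ(Γ⧸V, A^V) → Hⁿ(Γ⧸W, A^W)`, `W ≤ V` open normal:
with `V' = θ(V)`, `Γ⧸V ≅ Γ'⧸V'` carries `c` to a layer class of `Γ'`, which dies at some `W' ≤ V'`
(`LayerColimit.exists_stepG_eq_zero`), and `W = θ⁻¹(W')` works (`groupCohomology.map_comp`).
[cite: SerreGaloisCohomology1997, I §2.2 Proposition 8] -/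
theorem exists_stepG_eq_zero_of_surjection (ρ : ContinuousRep Γ k A) (hρ : ∀ (g : Γ) (a : A), ρ g a = a)
    (ρ' : ContinuousRep Γ' k A) (hρ' : ∀ (g : Γ') (a : A), ρ' g a = a)
    (θ : Γ →* Γ') (hθ : Continuous θ) (hs : Function.Surjective θ) (n : ℕ)
    (h' : ∀ x : Ext (triv (Γ := Γ') k) (stdBase ρ'.toTopRep (isDiscrete_of_continuousRep ρ')) n, x = 0)
    (V : OpenNormalSubgroup Γ) (hker : θ.ker ≤ (V : Subgroup Γ))
    (c : groupCohomology ((invariantsQuotFunctor k (V : Subgroup Γ)).obj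
      (stdBase ρ.toTopRep (isDiscrete_of_continuousRep ρ))) n) :
    ∃ (W : OpenNormalSubgroup Γ) (hWV : (W : Subgroup Γ) ≤ V),
      LayerColimit.stepG V W hWV (stdBase ρ.toTopRep (isDiscrete_of_continuousRep ρ)) n c = 0 := by
  classical
  -- notation
  let M : DiscreteRepCat k Γ := stdBase ρ.toTopRep (isDiscrete_of_continuousRep ρ)
  let M' : DiscreteRepCat k Γ' := stdBase ρ'.toTopRep (isDiscrete_of_continuousRep ρ')
  -- the image layer `V' = θ(V)`
  obtain ⟨V', hV'⟩ : ∃ V' : OpenNormalSubgroup Γ', (V' : Subgroup Γ') = (V : Subgroup Γ).map θ :=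
    ⟨{ toSubgroup := (V : Subgroup Γ).map θ
       isOpen' := isOpen_coe_map_of_surjective θ hθ hs V V.isOpen
       isNormal' := Subgroup.Normal.map inferInstance θ hs }, rfl⟩
  have hVV' : ∀ g : Γ, g ∈ (V : Subgroup Γ) ↔ θ g ∈ (V' : Subgroup Γ') := fun g => by
    rw [hV', ← Subgroup.mem_comap, Subgroup.comap_map_eq_self hker]
  -- the transport isomorphism at a compatible pair of layers `(U, U')`, `U = θ⁻¹(U')`
  -- (group iso `Γ⧸U ≃* Γ'⧸U'`, module iso `A^U ≃ A^{U'}` = identity on vectors)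
  have key : ∀ (U : OpenNormalSubgroup Γ) (U' : OpenNormalSubgroup Γ')
      (hU : ∀ g : Γ, g ∈ (U : Subgroup Γ) ↔ θ g ∈ (U' : Subgroup Γ')),
      ∃ (e : Γ ⧸ (U : Subgroup Γ) ≃* Γ' ⧸ (U' : Subgroup Γ'))
        (e' : ((invariantsQuotFunctor k (U : Subgroup Γ)).obj M).V ≃ₗ[k]
          ((invariantsQuotFunctor k (U' : Subgroup Γ')).obj M').V),
        (∀ g : Γ, e (QuotientGroup.mk g) = QuotientGroup.mk (θ g)) ∧
        (∀ x, ((e' x).1 : A) = x.1) ∧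
        ∀ g, (e'.toLinearMap ∘ₗ ((invariantsQuotFunctor k (U : Subgroup Γ)).obj M).ρ g) =
          (((invariantsQuotFunctor k (U' : Subgroup Γ')).obj M').ρ (e g) ∘ₗ e'.toLinearMap) := by
    intro U U' hU
    let e : Γ ⧸ (U : Subgroup Γ) ≃* Γ' ⧸ (U' : Subgroup Γ') :=
      MulEquiv.ofBijective (QuotientGroup.map (U : Subgroup Γ) (U' : Subgroup Γ') θ fun g hg => (hU g).1 hg)
        (bijective_quotientMap_of_forall_mem_iff θ hs (U : Subgroup Γ) (U' : Subgroup Γ') hU)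
    have he : ∀ g : Γ, e (QuotientGroup.mk g) = QuotientGroup.mk (θ g) := fun g => rfl
    -- the module map: identity on vectors (everything is invariant, the actions being trivial)
    have hmem' : ∀ x : ((invariantsQuotFunctor k (U : Subgroup Γ)).obj M).V,
        (x.1 : A) ∈ Representation.invariants (M'.obj.ρ.comp (U' : Subgroup Γ').subtype) :=
      fun x u => hρ' _ _
    have hmem : ∀ y : ((invariantsQuotFunctor k (U' : Subgroup Γ')).obj M').V,
        (y.1 : A) ∈ Representation.invariants (M.obj.ρ.comp (U : Subgroup Γ).subtype) :=
      fun y u => hρ _ _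
    let e' : ((invariantsQuotFunctor k (U : Subgroup Γ)).obj M).V ≃ₗ[k]
        ((invariantsQuotFunctor k (U' : Subgroup Γ')).obj M').V :=
      { toFun := fun x => ⟨x.1, hmem' x⟩
        map_add' := fun _ _ => rfl
        map_smul' := fun _ _ => rfl
        invFun := fun y => ⟨y.1, hmem y⟩
        left_inv := fun _ => rfl
        right_inv := fun _ => rfl }
    refine ⟨e, e', he, fun _ => rfl, fun q => ?_⟩
    induction q using QuotientGroup.induction_on with
    | H g =>
      refine LinearMap.ext fun x => Subtype.ext ?_
      change (ρ g x.1 : A) = ρ' (θ g) x.1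
      rw [hρ, hρ']
  -- transport at `V`: `c = τ_V c'`
  obtain ⟨eV, eV', heV, heV'1, heVρ⟩ := key V V' hVV'
  let iV := groupCohomology.mapIso eV eV' heVρ n
  let c' : groupCohomology ((invariantsQuotFunctor k (V' : Subgroup Γ')).obj M') n := iV.hom c
  have hc' : iV.inv c' = c := by
    change (iV.hom ≫ iV.inv) c = c
    rw [iV.hom_inv_id]
    rfl
  -- `c'` dies deeper in `Γ'`
  obtain ⟨W', hW'V', hW'⟩ := LayerColimit.exists_stepG_eq_zero n M' V' c' (h' _)
  -- pull `W'` back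
  obtain ⟨W, hW⟩ : ∃ W : OpenNormalSubgroup Γ, (W : Subgroup Γ) = (W' : Subgroup Γ').comap θ :=
    ⟨{ toSubgroup := (W' : Subgroup Γ').comap θ
       isOpen' := W'.isOpen.preimage hθ
       isNormal' := Subgroup.Normal.comap inferInstance θ }, rfl⟩
  have hWW' : ∀ g : Γ, g ∈ (W : Subgroup Γ) ↔ θ g ∈ (W' : Subgroup Γ') := fun g => by
    rw [hW, Subgroup.mem_comap]
  have hWV : (W : Subgroup Γ) ≤ V := fun g hg => (hVV' g).2 (hW'V' ((hWW' g).1 hg))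
  obtain ⟨eW, eW', heW, heW'1, heWρ⟩ := key W W' hWW'
  let iW := groupCohomology.mapIso eW eW' heWρ n
  refine ⟨W, hWV, ?_⟩
  -- naturality: `τ_W ∘ stepG' V' W' = stepG V W ∘ τ_V`
  have hnat : LayerColimit.stepG V' W' hW'V' M' n ≫ iW.inv = iV.inv ≫ LayerColimit.stepG V W hWV M n := by
    change groupCohomology.map _ _ n ≫ groupCohomology.map _ _ n =
      groupCohomology.map _ _ n ≫ groupCohomology.map _ _ n
    rw [← groupCohomology.map_comp, ← groupCohomology.map_comp]
    refine groupCohomology.map_congr ?_ ?_ n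
    · refine MonoidHom.ext fun q => ?_
      induction q using QuotientGroup.induction_on with
      | H g =>
        change quotMap (V' : Subgroup Γ') (W' : Subgroup Γ') hW'V' (eW (QuotientGroup.mk g)) =
          eV (quotMap (V : Subgroup Γ) (W : Subgroup Γ) hWV (QuotientGroup.mk g))
        rw [heW, quotMap_mk, quotMap_mk, heV]
    · refine LinearMap.ext fun x => Subtype.ext ?_
      change ((eW'.symm (⟨(x.1 : A), _⟩)).1 : A) = (eV'.symm x).1
      have h1 : ∀ y, ((eW'.symm y).1 : A) = y.1 := fun y => by
        conv_rhs => rw [← eW'.apply_symm_apply y]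
        rw [heW'1]
      have h2 : ∀ y, ((eV'.symm y).1 : A) = y.1 := fun y => by
        conv_rhs => rw [← eV'.apply_symm_apply y]
        rw [heV'1]
      rw [h1, h2]
  have := congrArg (fun f => f c') hnat
  change iW.inv (LayerColimit.stepG V' W' hW'V' M' n c') = LayerColimit.stepG V W hWV M n (iV.inv c') at this
  rw [hW', map_zero, hc'] at this
  exact this.symm

end Layer

/-! ## §3 `Hⁿ_cont = 0` ⟺ `Extⁿ_{C_Γ} = 0`, and the descent theorem -/

section Main

variable {k Γ : Type u} [CommRing k] [TopologicalSpace k] [Group Γ] [TopologicalSpace Γ]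
  [IsTopologicalGroup Γ] [CompactSpace Γ]
  {A : Type u} [AddCommGroup A] [Module k A] [TopologicalSpace A] [DiscreteTopology A]
  [IsTopologicalAddGroup A] [ContinuousSMul k A]

/-- `Hⁿ_cont(Γ, A) = 0` when `Extⁿ_{C_Γ}(k, A) = 0` (the comparison `extTrivAddEquivContinuousCohomology`).
[cite: SerreGaloisCohomology1997, I §2.5] -/
theorem subsingleton_continuousCohomology_of_forall_ext_eq_zero (ρ : ContinuousRep Γ k A) (n : ℕ)
    (h : ∀ x : Ext (triv (Γ := Γ) k) (stdBase ρ.toTopRep (isDiscrete_of_continuousRep ρ)) n, x = 0) :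
    Subsingleton (continuousCohomology n ρ.toTopRep) := by
  let Φ := extTrivAddEquivContinuousCohomology ρ.toTopRep (isDiscrete_of_continuousRep ρ) n
  refine ⟨fun a b => ?_⟩
  rw [← Φ.apply_symm_apply a, ← Φ.apply_symm_apply b, h (Φ.symm a), h (Φ.symm b)]

/-- `Extⁿ_{C_Γ}(k, A) = 0` when `Hⁿ_cont(Γ, A) = 0` (the comparison `extTrivAddEquivContinuousCohomology`).
[cite: SerreGaloisCohomology1997, I §2.5] -/
theorem forall_ext_eq_zero_of_subsingleton_continuousCohomology (ρ : ContinuousRep Γ k A) (n : ℕ)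
    [h : Subsingleton (continuousCohomology n ρ.toTopRep)]
    (x : Ext (triv (Γ := Γ) k) (stdBase ρ.toTopRep (isDiscrete_of_continuousRep ρ)) n) : x = 0 := by
  apply (extTrivAddEquivContinuousCohomology ρ.toTopRep (isDiscrete_of_continuousRep ρ) n).injective
  rw [map_zero]
  exact Subsingleton.elim _ _

variable [TotallyDisconnectedSpace Γ]

/-- **Vanishing of `Hⁿ_cont(Γ, A)` (trivial discrete coefficients) descends along a cofinal family of
quotients.**  `Γ` profinite acting trivially on the discrete module `A`; `θᵢ : Γ ↠ Γ'ᵢ` continuous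
surjections onto profinite groups acting trivially on `A`, such that every open normal `V ⊴ Γ` contains
some `ker θᵢ`.  If `Hⁿ_cont(Γ'ᵢ, A) = 0` for all `i`, then `Hⁿ_cont(Γ, A) = 0`.  (Serre I §2.2 Prop. 8:
`Hⁿ(Γ, A) = lim→_V Hⁿ(Γ⧸V, A)`, and every layer `Γ⧸V`, `V ⊇ ker θᵢ`, is a layer of `Γ'ᵢ`; proof =
`LayerColimit.forall_ext_eq_zero_iff` + `exists_stepG_eq_zero_of_surjection`.)
[cite: SerreGaloisCohomology1997, I §2.2 Proposition 8 and Corollary 1]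
[cite: NeukirchSchmidtWingberg2008, (1.5.1)] -/
theorem subsingleton_continuousCohomology_trivial_of_cofinal_surjections
    (ρ : ContinuousRep Γ k A) (hρ : ∀ (g : Γ) (a : A), ρ g a = a)
    {ι : Type*} {Γ' : ι → Type u} [∀ i, Group (Γ' i)] [∀ i, TopologicalSpace (Γ' i)]
    [∀ i, IsTopologicalGroup (Γ' i)] [∀ i, CompactSpace (Γ' i)] [∀ i, TotallyDisconnectedSpace (Γ' i)]
    [∀ i, T2Space (Γ' i)]
    (ρ' : ∀ i, ContinuousRep (Γ' i) k A) (hρ' : ∀ (i : ι) (g : Γ' i) (a : A), ρ' i g a = a)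
    (θ : ∀ i, Γ →* Γ' i) (hθ : ∀ i, Continuous (θ i)) (hs : ∀ i, Function.Surjective (θ i))
    (hcof : ∀ V : OpenNormalSubgroup Γ, ∃ i, (θ i).ker ≤ (V : Subgroup Γ)) (n : ℕ)
    (h : ∀ i, Subsingleton (continuousCohomology n (ρ' i).toTopRep)) :
    Subsingleton (continuousCohomology n ρ.toTopRep) := by
  refine subsingleton_continuousCohomology_of_forall_ext_eq_zero ρ n ?_
  refine (LayerColimit.forall_ext_eq_zero_iff n _).2 fun V c => ?_
  obtain ⟨i, hi⟩ := hcof V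
  haveI := h i
  exact exists_stepG_eq_zero_of_surjection ρ hρ (ρ' i) (hρ' i) (θ i) (hθ i) (hs i) n
    (forall_ext_eq_zero_of_subsingleton_continuousCohomology (ρ' i) n) V hi c

end Main

end DiscreteRep

end Literature.Algebra.Homology
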